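import Summits.ResolutionOfSingularities.ResolutionOfSingularities.Theorems.FrobeniusLadderFInjectiveMacaulayficationVeroneseLocalization
import Summits.ResolutionOfSingularities.ResolutionOfSingularities.Theorems.FrobeniusLadderFInjectiveMacaulayficationGradedChartLaurentStep
import Summits.ResolutionOfSingularities.ResolutionOfSingularities.Theorems.FrobeniusLadderFInjectiveMacaulayficationFiniteGradedDescent
import Summits.ResolutionOfSingularities.ResolutionOfSingularities.Theorems.FrobeniusLadderFInjectiveMacaulayficationIntegralSubalgebraLocalDim
import Summits.ResolutionOfSingularities.ResolutionOfSingularities.Theorems.FrobeniusLadderFInjectiveMacaulayficationLaurentDescent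
import Summits.ResolutionOfSingularities.ResolutionOfSingularities.Theorems.FrobeniusLadderFInjectiveMacaulayficationWeightedConeCore
import Summits.ResolutionOfSingularities.ResolutionOfSingularities.Theorems.FrobeniusLadderFInjectiveMacaulayficationClauseOfMaximal
import Literature.RingTheory.KrullDimension.AffineDimension
import Mathlib.RingTheory.Localization.LocalizationLocalization
import HarnessLib

/-!
# G4 `stub_gradedChartClause`: THE GRADED CHART CLAUSE (crux `FInjectiveMacaulayfication`, §16 line `graded-engine`)

Proof file for the registered stub G4 `stub_gradedChartClause` of crux stmt-ResolutionOfSingularities-15315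
(`FrobeniusLadder.FInjectiveMacaulayfication`), skeleton v11 `86e9127b`, §16 THE GRADED ENGINE (CRUX-PLAN w45a v3; lead
seat res-L1-w45a-lead-1; design memo GRADED-ENGINE.md v2). [OURS · L1 W4.5a]

THE STATEMENT. `k` a field of characteristic `p`, weights `w`, `N = c·w_v`, `I_N = (monomials of weight ≥ N)` with the
VERONESE SATURATION hypothesis (`x̄^b ∈ I_N^K` when `wt b ≥ K N`), `f` weighted homogeneous of weight `D` with `(f)` prime
and no `x̄ⱼ = 0`, and the CLAUSE (every system of parameters weakly regular with Frobenius closed ideal) for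
`R = k[X]/(f)` at its maximal ideals missing some variable (off the origin of the cone). THEN the weighted blow-up chart
`C = R[I_N R/x̄_v^c]` satisfies the Cohen–Macaulay + Frobenius-closed clause at every maximal `Q ∋ x̄_v^c`.

THE PROOF (all `p`, no μ-cover hypothesis; `u = x̄_v^c`, `L = R[1/u]`, `T' = L[s]`):
1. the clause holds for `L` at every prime (`clause_away`: primes of `L` are primes of `R` not containing `x̄_v`,
   hence below a maximal ideal off the origin, by Jacobson — `WeightedConeCore.exists_maximal_not_mem_X` +
   `ClauseOfMaximal.fiClause_atPrime_of_le`);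
2. hence `T' = L[s]` satisfies the clause at every prime containing `s` (Fedder deformation E1 p136373,
   `GradedChartDescent.clause_localization_polynomial_of_mem`);
3. the weight grading (coaction `λ`, `WeightCoaction` p480895), the chart iso `ι : C ≅ T₀` (`GradedChartIso` p481846),
   the Veronese subalgebra `A' ⊇ T₀` with `s^N ∈ A'`, `T'` integral over `A'` and the retraction `ρ` (`VeroneseSubalgebra`
   p482592, `VeroneseRetract` p482980) feed FINITE GRADED DESCENT (p173797): `A'` satisfies the clause at its maximal
   ideals containing `s^N` (equidimensionality from `AffineDomainEquidim` and `IntegralSubalgebraLocalDim` p456856);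
4. `A' = C[Y]_Y` along `Y ↦ u/1` (`VeroneseLocalization`), so `C[Y]` satisfies the clause at `𝔑 = Q C[Y] + (Y - 1)`
   (`GradedChartDescent.clause_of_isLocalization_away`; `s^N = (1/u)·ι(u) ∈ 𝔑 A'`);
5. LAURENT DESCENT (p470480) brings it down to `C_Q`.
* `gradedChartClause` — the general form (`u = ā₀` any nonzero weighted homogeneous element of positive weight in
  the ideal of the variables);
* `stub_gradedChartClause` — the registered signature (`a₀ = X_v^c`).
No definitions, no named facts. [folklore]
-/

set_option linter.dupNamespace false

noncomputable section

open LaurentPolynomial Literature.AlgebraicGeometry.Resolution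

namespace Summit.ResolutionOfSingularities.ResolutionOfSingularities.Theorems.FInjectiveMacaulayfication.GradedChartClause

open Summit.ResolutionOfSingularities.ResolutionOfSingularities.Theorems.FInjectiveMacaulayfication
open WeightCoaction GradedChartIso VeroneseSubalgebra VeroneseRetract VeroneseLocalization GradedChartDescent
open GradedChartLaurentStep

/-! ## Step 1: the clause for `L = R[1/u]` at every prime -/

/-- **The clause for `L = R[1/u]` at every prime**, from the clause for `R = k[X]/(f)` at the maximal ideals missing a
variable: a prime `𝔮` of `L` contracts to a prime `𝔭 ∌ u` of `R`; as `u` lies in the ideal of the variables, Jacobson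
gives a maximal `Q₀ ⊇ 𝔭` missing some `x̄ⱼ`; the clause localises from `R_{Q₀}` to `R_𝔭 ≅ L_𝔮`
(`ClauseOfMaximal.fiClause_atPrime_of_le`, `DegreeZeroDescent.inlineClause_of_ringEquiv`). [folklore] -/
theorem clause_away (p : ℕ) [Fact p.Prime] (k : Type) [Field k] [CharP k p] (n : ℕ) (f : MvPolynomial (Fin n) k)
    (hfprime : (Ideal.span {f}).IsPrime) (u : MvPolynomial (Fin n) k ⧸ Ideal.span {f})
    (huX : u ∈ Ideal.span (Set.range fun j : Fin n => Ideal.Quotient.mk (Ideal.span {f}) (MvPolynomial.X j)))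
    (hoff : ∀ (Q : Ideal (MvPolynomial (Fin n) k ⧸ Ideal.span {f})) [Q.IsMaximal],
      (∃ j : Fin n, Ideal.Quotient.mk (Ideal.span {f}) (MvPolynomial.X j) ∉ Q) →
      ∀ d : ℕ, ringKrullDim (Localization.AtPrime Q) = d → ∀ s : Fin d → Localization.AtPrime Q,
        (Ideal.span (Set.range s)).radical.IsMaximal →
          RingTheory.Sequence.IsWeaklyRegular (Localization.AtPrime Q) (List.ofFn s) ∧
          ∀ y : Localization.AtPrime Q, (∃ e : ℕ, y ^ p ^ e ∈ Ideal.span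
            ((fun z : Localization.AtPrime Q => z ^ p ^ e) ''
              (Ideal.span (Set.range s) : Set (Localization.AtPrime Q)))) → y ∈ Ideal.span (Set.range s))
    (𝔮 : Ideal (Localization.Away u)) [𝔮.IsPrime] :
    ∀ d : ℕ, ringKrullDim (Localization.AtPrime 𝔮) = d → ∀ s : Fin d → Localization.AtPrime 𝔮,
      (Ideal.span (Set.range s)).radical.IsMaximal →
        RingTheory.Sequence.IsWeaklyRegular (Localization.AtPrime 𝔮) (List.ofFn s) ∧
        ∀ y : Localization.AtPrime 𝔮, (∃ e : ℕ, y ^ p ^ e ∈ Ideal.span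
          ((fun z : Localization.AtPrime 𝔮 => z ^ p ^ e) ''
            (Ideal.span (Set.range s) : Set (Localization.AtPrime 𝔮)))) → y ∈ Ideal.span (Set.range s) := by
  haveI := hfprime
  haveI : IsDomain (MvPolynomial (Fin n) k ⧸ Ideal.span {f}) := Ideal.Quotient.isDomain _
  haveI : CharP (MvPolynomial (Fin n) k ⧸ Ideal.span {f}) p :=
    charP_of_injective_algebraMap (algebraMap k (MvPolynomial (Fin n) k ⧸ Ideal.span {f})).injective p
  -- the contraction `𝔭 ∌ u`
  haveI h𝔭 : (𝔮.comap (algebraMap (MvPolynomial (Fin n) k ⧸ Ideal.span {f}) (Localization.Away u))).IsPrime :=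
    Ideal.comap_isPrime _ _
  have hu𝔭 : ¬ Ideal.span {u} ≤ 𝔮.comap (algebraMap (MvPolynomial (Fin n) k ⧸ Ideal.span {f}) (Localization.Away u)) := by
    intro h
    have hu : u ∈ 𝔮.comap (algebraMap _ (Localization.Away u)) := h (Ideal.mem_span_singleton_self u)
    rw [Ideal.mem_comap] at hu
    exact (Ideal.IsPrime.ne_top inferInstance) (𝔮.eq_top_of_isUnit_mem hu (IsLocalization.Away.algebraMap_isUnit u))
  have hle : Ideal.span {u} ≤ Ideal.span (Set.range fun j : Fin n => Ideal.Quotient.mk (Ideal.span {f}) (MvPolynomial.X j)) := by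
    rw [Ideal.span_le, Set.singleton_subset_iff]
    exact huX
  obtain ⟨Q₀, hQ₀, h𝔭Q₀, j, hj⟩ := WeightedConeCore.exists_maximal_not_mem_X f (Ideal.span {u}) hle _ hu𝔭
  haveI := hQ₀
  have h := ClauseOfMaximal.fiClause_atPrime_of_le p h𝔭Q₀ ⟨inferInstance, hoff Q₀ ⟨j, hj⟩⟩
  exact DegreeZeroDescent.inlineClause_of_ringEquiv p
    (IsLocalization.localizationLocalizationAtPrimeIsoLocalization (Submonoid.powers u) 𝔮).toRingEquiv h.2

/-! ## Steps 2–5: the graded chart clause, general form -/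

set_option maxHeartbeats 800000 in
/-- **THE GRADED CHART CLAUSE (general form).** `f` weighted homogeneous of weight `D` with `(f)` prime, `u = ā₀ ≠ 0`
for a weighted homogeneous `a₀` of weight `N > 0` lying in the ideal of the variables, Veronese saturation of `I_N`,
and the clause for `R = k[X]/(f)` at the maximal ideals missing a variable. Then the chart `C = R[I_N R/u]` satisfies
the Cohen–Macaulay + Frobenius-closed clause at every maximal ideal `Q ∋ u`. Proof: module docstring, steps 1–5.
[folklore] -/
theorem gradedChartClause (p : ℕ) [Fact p.Prime] (k : Type) [Field k] [CharP k p] (n : ℕ) (w : Fin n → ℕ)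
    (f : MvPolynomial (Fin n) k) (D : ℕ) (hf : MvPolynomial.IsWeightedHomogeneous w f D) (hfprime : (Ideal.span {f}).IsPrime)
    (N : ℕ) (hN : 0 < N) (a₀ : MvPolynomial (Fin n) k) (ha₀ : MvPolynomial.IsWeightedHomogeneous w a₀ N)
    (u : MvPolynomial (Fin n) k ⧸ Ideal.span {f}) (hu : Ideal.Quotient.mk (Ideal.span {f}) a₀ = u) (hu0 : u ≠ 0)
    (huX : u ∈ Ideal.span (Set.range fun j : Fin n => Ideal.Quotient.mk (Ideal.span {f}) (MvPolynomial.X j)))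
    (hpow : ∀ (K : ℕ) (b : Fin n →₀ ℕ), K * N ≤ Finsupp.weight w b → (MvPolynomial.monomial b (1 : k) : MvPolynomial (Fin n) k) ∈
      (Ideal.span {m : MvPolynomial (Fin n) k | ∃ b : Fin n →₀ ℕ, N ≤ Finsupp.weight w b ∧ m = MvPolynomial.monomial b 1}) ^ K)
    (hoff : ∀ (Q : Ideal (MvPolynomial (Fin n) k ⧸ Ideal.span {f})) [Q.IsMaximal],
      (∃ j : Fin n, Ideal.Quotient.mk (Ideal.span {f}) (MvPolynomial.X j) ∉ Q) →
      ∀ d : ℕ, ringKrullDim (Localization.AtPrime Q) = d → ∀ s : Fin d → Localization.AtPrime Q,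
        (Ideal.span (Set.range s)).radical.IsMaximal →
          RingTheory.Sequence.IsWeaklyRegular (Localization.AtPrime Q) (List.ofFn s) ∧
          ∀ y : Localization.AtPrime Q, (∃ e : ℕ, y ^ p ^ e ∈ Ideal.span
            ((fun z : Localization.AtPrime Q => z ^ p ^ e) ''
              (Ideal.span (Set.range s) : Set (Localization.AtPrime Q)))) → y ∈ Ideal.span (Set.range s))
    (Q : Ideal (blowupAlgebra ((Ideal.span {m : MvPolynomial (Fin n) k | ∃ b : Fin n →₀ ℕ, N ≤ Finsupp.weight w b ∧
        m = MvPolynomial.monomial b 1}).map (Ideal.Quotient.mk (Ideal.span {f}))) u)) [Q.IsMaximal]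
    (huQ : algebraMap (MvPolynomial (Fin n) k ⧸ Ideal.span {f}) (blowupAlgebra ((Ideal.span {m : MvPolynomial (Fin n) k |
        ∃ b : Fin n →₀ ℕ, N ≤ Finsupp.weight w b ∧ m = MvPolynomial.monomial b 1}).map (Ideal.Quotient.mk (Ideal.span {f}))) u) u ∈ Q) :
    ∀ d : ℕ, ringKrullDim (Localization.AtPrime Q) = d → ∀ s : Fin d → Localization.AtPrime Q,
      (Ideal.span (Set.range s)).radical.IsMaximal →
        RingTheory.Sequence.IsWeaklyRegular (Localization.AtPrime Q) (List.ofFn s) ∧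
        ∀ y : Localization.AtPrime Q, (∃ e : ℕ, y ^ p ^ e ∈ Ideal.span
          ((fun z : Localization.AtPrime Q => z ^ p ^ e) ''
            (Ideal.span (Set.range s) : Set (Localization.AtPrime Q)))) → y ∈ Ideal.span (Set.range s) := by
  classical
  haveI := hfprime
  -- the rings `R`, `L = R[1/u]`, `L[s]`, `C`
  haveI : IsDomain (MvPolynomial (Fin n) k ⧸ Ideal.span {f}) := Ideal.Quotient.isDomain _
  haveI : CharP (MvPolynomial (Fin n) k ⧸ Ideal.span {f}) p :=
    charP_of_injective_algebraMap (algebraMap k (MvPolynomial (Fin n) k ⧸ Ideal.span {f})).injective p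
  haveI : IsDomain (Localization.Away u) :=
    IsLocalization.isDomain_localization (powers_le_nonZeroDivisors_of_noZeroDivisors hu0)
  haveI : IsNoetherianRing (Localization.Away u) :=
    IsLocalization.isNoetherianRing (Submonoid.powers u) (Localization.Away u) inferInstance
  haveI : CharP (Localization.Away u) p :=
    charP_of_injective_algebraMap (algebraMap k (Localization.Away u)).injective p
  haveI : Algebra.FiniteType k (Localization.Away u) :=
    (inferInstance : Algebra.FiniteType k (MvPolynomial (Fin n) k ⧸ Ideal.span {f})).trans
      (IsLocalization.finiteType_of_monoid_fg (Submonoid.powers u) (Localization.Away u))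
  haveI : NeZero N := NeZero.of_pos hN
  -- the coaction and the graded objects
  obtain ⟨lam, hlam⟩ := exists_coaction w f u ha₀ hu D hf
  obtain ⟨T₀, hT₀⟩ := exists_degreeZeroSubalgebra w f u lam hlam
  have hι' := exists_chartIso w f u ha₀ hu lam hlam hpow T₀ hT₀
  obtain ⟨ι, hι⟩ := hι'
  have hA'' := exists_veroneseSubalgebra w f u ha₀ hu lam hlam N
  obtain ⟨A', hA'⟩ := hA''
  have hρ' := exists_veroneseRetract w f u ha₀ hu lam hlam N A' hA'
  obtain ⟨ρ, hρ⟩ := hρ'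
  haveI : Algebra.IsIntegral A' (Polynomial (Localization.Away u)) :=
    isIntegral_veronese w f u ha₀ hu lam hlam N A' hA' hN (ZMod.natCast_self N)
  have hXN : (Polynomial.X : Polynomial (Localization.Away u)) ^ N ∈ A' :=
    X_pow_mem_veronese f u lam N A' hA' N (ZMod.natCast_self N)
  have hCinv : Polynomial.C (IsLocalization.Away.invSelf (S := Localization.Away u) u) ∈ A' :=
    C_mem_veronese_of_isHomogeneous f u lam N A' hA' (coaction_invSelf w f u ha₀ hu lam hlam)
      (by push_cast; rw [ZMod.natCast_self, neg_zero])
  have he' := exists_laurentLocalization w f u ha₀ hu lam hlam T₀ hT₀ A' hA' _ ι hN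
  obtain ⟨e, heC, heX, hloc⟩ := he'
  -- steps 1–2: `L[s]` satisfies the clause at the maximal ideals containing `s`
  have hclL := clause_away p k n f hfprime u huX hoff
  have hclB := fun (Q' : Ideal (Polynomial (Localization.Away u))) (hQ' : Q'.IsMaximal)
      (hXQ' : (Polynomial.X : Polynomial (Localization.Away u)) ∈ Q') =>
    (clause_localization_polynomial_of_mem p (Localization.Away u) (fun 𝔮 _ => hclL 𝔮) Q' hXQ').2
  -- step 3: equidimensionality and finite graded descent
  obtain ⟨m, hm, -⟩ := exists_ringKrullDim_eq_and_trdeg_eq k (Polynomial (Localization.Away u))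
  have hdimB := fun (Q' : Ideal (Polynomial (Localization.Away u))) (hQ' : Q'.IsMaximal) =>
    (ringKrullDim_localization_atPrime_eq_of_isMaximal k Q').trans hm
  have hdimA := IntegralSubalgebraLocalDim.stub_integralSubalgebraLocalDim k _ A' m hdimB
  have hclA' := FiniteGradedDescent.stub_finiteGradedDescent p k (Polynomial (Localization.Away u)) A' ρ hρ
    Polynomial.X N m hXN hdimB hdimA hclB
  -- steps 4–5: pull back along `C[Y] → A' = C[Y]_Y` and Laurent-descend to `C_Q`
  haveI : Algebra.FiniteType k (blowupAlgebra ((Ideal.span {m : MvPolynomial (Fin n) k | ∃ b : Fin n →₀ ℕ,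
      N ≤ Finsupp.weight w b ∧ m = MvPolynomial.monomial b 1}).map (Ideal.Quotient.mk (Ideal.span {f}))) u) :=
    (inferInstance : Algebra.FiniteType k (MvPolynomial (Fin n) k ⧸ Ideal.span {f})).trans
      (finiteType_blowupAlgebra _ (IsNoetherian.noetherian _) u)
  refine clause_of_isLocalization_away_descent p e hloc ⟨Polynomial.X ^ N, hXN⟩ hclA' Q _ huQ ⟨_, hCinv⟩
    (Subtype.ext ?_) (fun 𝔑 _ => ringKrullDim_localization_polynomial_succ k _ Q 𝔑)
  -- `s^N = (1/u) · ι(u)` in `L[s]`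
  rw [Subalgebra.coe_mul, heC, chartIso_algebraMap_u w f u ha₀ hu lam hlam ι hι, ← mul_assoc, ← map_mul,
    mul_comm (IsLocalization.Away.invSelf u), IsLocalization.Away.mul_invSelf, map_one, one_mul]

/-! ## The registered stub -/

/-- G4 **THE GRADED CHART CLAUSE** (registered stub `stub_gradedChartClause`, skeleton v11 of crux
stmt-ResolutionOfSingularities-15315): for `f` weighted-homogeneous of weight `D` (weights `w`, `N = c·w_v`, Veronese
saturation of `I_N`), `(f)` prime, all `x̄ⱼ ≠ 0`: the clause for `R = k[X]/(f)` at the maximal ideals missing some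
variable implies the Cohen–Macaulay + Frobenius-closed clause for the blow-up chart `R[I_N R/x̄_v^c]` at its maximal
ideals containing `x̄_v^c` — at EVERY prime `p`, with no hypothesis on μ-cover charts (`gradedChartClause` with
`a₀ = X_v^c`). [folklore] -/
theorem stub_gradedChartClause : ∀ (p : ℕ) [Fact p.Prime] (k : Type) [Field k] [CharP k p] (n : ℕ) (w : Fin n → ℕ) (v : Fin n),
    0 < w v → ∀ (N c D : ℕ), c * w v = N → 0 < c →
    (∀ (K : ℕ) (b : Fin n →₀ ℕ), K * N ≤ Finsupp.weight w b → (MvPolynomial.monomial b (1 : k) : MvPolynomial (Fin n) k) ∈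
      (Ideal.span {m : MvPolynomial (Fin n) k | ∃ b : Fin n →₀ ℕ, N ≤ Finsupp.weight w b ∧ m = MvPolynomial.monomial b 1}) ^ K) →
    ∀ (f : MvPolynomial (Fin n) k), MvPolynomial.IsWeightedHomogeneous w f D → (Ideal.span {f}).IsPrime →
    (∀ j : Fin n, Ideal.Quotient.mk (Ideal.span {f}) (MvPolynomial.X j) ≠ 0) →
    (∀ (Q : Ideal (MvPolynomial (Fin n) k ⧸ Ideal.span {f})) [Q.IsMaximal],
      (∃ j : Fin n, Ideal.Quotient.mk (Ideal.span {f}) (MvPolynomial.X j) ∉ Q) →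
      ∀ d : ℕ, ringKrullDim (Localization.AtPrime Q) = d → ∀ s : Fin d → Localization.AtPrime Q,
        (Ideal.span (Set.range s)).radical.IsMaximal →
          RingTheory.Sequence.IsWeaklyRegular (Localization.AtPrime Q) (List.ofFn s) ∧
          ∀ y : Localization.AtPrime Q, (∃ e : ℕ, y ^ p ^ e ∈ Ideal.span
            ((fun z : Localization.AtPrime Q => z ^ p ^ e) ''
              (Ideal.span (Set.range s) : Set (Localization.AtPrime Q)))) → y ∈ Ideal.span (Set.range s)) →
    ∀ (Q : Ideal (blowupAlgebra ((Ideal.span {m : MvPolynomial (Fin n) k | ∃ b : Fin n →₀ ℕ, N ≤ Finsupp.weight w b ∧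
        m = MvPolynomial.monomial b 1}).map (Ideal.Quotient.mk (Ideal.span {f}))) (Ideal.Quotient.mk (Ideal.span {f}) (MvPolynomial.X v) ^ c)))
      [Q.IsMaximal],
      algebraMap (MvPolynomial (Fin n) k ⧸ Ideal.span {f}) (blowupAlgebra ((Ideal.span {m : MvPolynomial (Fin n) k | ∃ b : Fin n →₀ ℕ,
        N ≤ Finsupp.weight w b ∧ m = MvPolynomial.monomial b 1}).map (Ideal.Quotient.mk (Ideal.span {f})))
          (Ideal.Quotient.mk (Ideal.span {f}) (MvPolynomial.X v) ^ c)) (Ideal.Quotient.mk (Ideal.span {f}) (MvPolynomial.X v) ^ c) ∈ Q →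
      ∀ d : ℕ, ringKrullDim (Localization.AtPrime Q) = d → ∀ s : Fin d → Localization.AtPrime Q,
        (Ideal.span (Set.range s)).radical.IsMaximal →
          RingTheory.Sequence.IsWeaklyRegular (Localization.AtPrime Q) (List.ofFn s) ∧
          ∀ y : Localization.AtPrime Q, (∃ e : ℕ, y ^ p ^ e ∈ Ideal.span
            ((fun z : Localization.AtPrime Q => z ^ p ^ e) ''
              (Ideal.span (Set.range s) : Set (Localization.AtPrime Q)))) → y ∈ Ideal.span (Set.range s) := by
  intro p _ k _ _ n w v hw N c D hcN hc hpow f hf hfprime hXne hoff Q _ huQ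
  have ha₀ : MvPolynomial.IsWeightedHomogeneous w (MvPolynomial.X v ^ c : MvPolynomial (Fin n) k) N := by
    have h := (MvPolynomial.isWeightedHomogeneous_X k w v).pow c
    rwa [smul_eq_mul, hcN] at h
  have hN : 0 < N := hcN ▸ Nat.mul_pos hc hw
  have huX : Ideal.Quotient.mk (Ideal.span {f}) (MvPolynomial.X v) ^ c ∈
      Ideal.span (Set.range fun j : Fin n => Ideal.Quotient.mk (Ideal.span {f}) (MvPolynomial.X j)) :=
    Ideal.pow_mem_of_mem _ (Ideal.subset_span (Set.mem_range_self v)) c hc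
  exact gradedChartClause p k n w f D hf hfprime N hN (MvPolynomial.X v ^ c) ha₀ _ (map_pow _ _ _) (pow_ne_zero c (hXne v))
    huX hpow hoff Q huQ

end Summit.ResolutionOfSingularities.ResolutionOfSingularities.Theorems.FInjectiveMacaulayfication.GradedChartClause

end
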